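import Mathlib.Analysis.SpecialFunctions.Pow.Real
import Mathlib.Analysis.SpecialFunctions.Log.Basic
import HarnessLib

/-!
# Main terms of the line `peel-to-drappeau` (crux `TypeI2Dilated`, stmt-Parity-14272) — VIII: final arithmetic

Pure real-variable bookkeeping for the last step of `stub_mainTerms`: the raw total of
`Theorems/LiouvilleShiftedTablesTypeI2DilatedMainTerms7.lean` (`total_raw_le`), with every arithmetic quantity
replaced by a real atom together with the elementary bound it satisfies for `x ≥ x₀`
(`K ≤ x^{1/1000}`, `N ≤ 2x`, `D₀ ≍ x^{3/1000}`, `F₀ ≍ (log x)^{A+134}`, `X₂, #T ≤ x^{2/1000}`, `W ≤ 19 log x`,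
the divisor sums `S₃ ≤ C₃ (log x)^{16}`, `S₅a ≤ X₂^6`, `S₅b ≤ C₅ (log x)^{128}`, the family bound
`B_f ≤ 2 C_f x/(log x)^{4A+404}`, and three `log`-vs-power absorptions), is at most `C x/(log x)^A` with
`C = 722 C_f + 12840960000 C₅ + 3`.

Ranges: (i) `K² W² (N/D₀) S₃ ≤ 1444 C₃ x^{0.999} (log x)^{18}` and `K² W² #T ≤ 361 x^{0.004} (log x)²`;
(ii) `F₀³ W (7 + 12 log D₀) B_f ≤ 722 C_f x/(log x)^A`; (iii) main `≤ 12840960000 C₅ x/(log x)^A`, error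
`≤ 3.3·10¹⁰ (log x)^6 x^{0.855}`.  [this line: Lines/peel-to-drappeau.md]
-/

noncomputable section

namespace Summit.Parity.GeneralizedHardyLittlewood.Cruxes.TypeI2Dilated.PeelToDrappeau

/-- Bookkeeping between `Real.rpow` and `Monoid.npow`: `x ^ r = (x ^ (1/3000)) ^ n` whenever
`r = n / 3000`, so that all the powers `x ^ (k/1000)`, `x ^ (1/2)`, `x ^ (1/10)`, `x ^ (5/6)` and
`x` itself become natural powers of the single atom `x ^ (1/3000)`. [folklore] -/
theorem rpow_eq_pow_root {x : ℝ} (hx : 0 ≤ x) (r : ℝ) (n : ℕ)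
    (hr : (1 / 3000 : ℝ) * n = r) : x ^ r = (x ^ (1 / 3000 : ℝ)) ^ n := by
  rw [← Real.rpow_natCast, ← Real.rpow_mul hx, hr]

/-- **Final arithmetic of the main terms.**  See the module docstring; `ℓx` stands for `log x` (only
`ℓx ≥ 2` is used), `KX` for `K X₂`. [this line] -/
theorem final_arith {A Cf C₃ C₅ x ℓx K N D₀ F₀ X₂ KX W cT S₃ S₅a S₅b Bf : ℝ}
    (hA : 0 < A) (hCf : 0 ≤ Cf) (hC₃ : 0 < C₃) (hC₅ : 0 < C₅)
    (hx : 16 ≤ x) (hℓx : 2 ≤ ℓx) (hℓxlog : Real.log x = ℓx)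
    (hK0 : 0 ≤ K) (hK : K ≤ x ^ (1 / 1000 : ℝ))
    (hN0 : 0 ≤ N) (hN : N ≤ 2 * x)
    (hD₀l : x ^ (3 / 1000 : ℝ) / 2 ≤ D₀) (hD₀u : D₀ ≤ x ^ (3 / 1000 : ℝ)) (hD₀1 : 1 ≤ D₀)
    (hF₀l : ℓx ^ (A + 134) / 2 ≤ F₀) (hF₀u : F₀ ≤ ℓx ^ (A + 134)) (hF₀1 : 1 ≤ F₀)
    (hX₂0 : 0 ≤ X₂) (hX₂ : X₂ ≤ x ^ (2 / 1000 : ℝ))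
    (hKX1 : 1 ≤ KX) (hKX : KX ≤ x ^ (3 / 1000 : ℝ))
    (hW0 : 0 ≤ W) (hW : W ≤ 19 * ℓx)
    (hcT0 : 0 ≤ cT) (hcT : cT ≤ x ^ (2 / 1000 : ℝ))
    (hS₃0 : 0 ≤ S₃) (hS₃ : S₃ ≤ C₃ * ℓx ^ (16 : ℕ))
    (hS₅a0 : 0 ≤ S₅a) (hS₅a : S₅a ≤ X₂ ^ (6 : ℕ))
    (hS₅b0 : 0 ≤ S₅b) (hS₅b : S₅b ≤ C₅ * ℓx ^ (128 : ℕ))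
    (hBf0 : 0 ≤ Bf) (hBf : Bf ≤ 2 * Cf * x / ℓx ^ (4 * A + 404))
    (hX₁ : ℓx ^ (A + 18) ≤ 1 / (1444 * C₃) * x ^ (1 / 1000 : ℝ))
    (hX₂' : ℓx ^ (A + 2) ≤ 1 / 361 * x ^ (1 / 2 : ℝ))
    (hX₃ : ℓx ^ (A + 6) ≤ 1 / 33000000000 * x ^ (1 / 10 : ℝ)) :
    K ^ 2 * W ^ 2 * (N / D₀ * S₃ + cT) +
        F₀ ^ 3 * W * (7 + 12 * Real.log D₀) * Bf +
        330000 * W * Real.log ((2 + N) * KX) ^ 4 / F₀ *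
          (D₀ * (2 + ((2 + N) ^ (5 / 6 : ℝ) * KX + (2 + N) ^ (1 / 2 : ℝ) * KX ^ 2) *
              (1 + Real.log (2 + N))) * S₅a +
            N * (1 + Real.log D₀) * S₅b) ≤
      (722 * Cf + 12840960000 * C₅ + 3) * x / ℓx ^ A := by
  have hx0 : 0 ≤ x := by linarith
  have hxpos : 0 < x := by linarith
  have hx1 : 1 ≤ x := by linarith
  have hℓpos : 0 < ℓx := by linarith
  have hxx : 16 * x ≤ x * x := mul_le_mul_of_nonneg_right hx hx0
  have hKXx : KX ≤ x :=
    hKX.trans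
      (by simpa using Real.rpow_le_rpow_of_exponent_le hx1 (by norm_num : (3 / 1000 : ℝ) ≤ 1))
  -- the three logarithms, in terms of `ℓx = log x`
  have hℓ₁ : Real.log D₀ ≤ 3 / 1000 * ℓx := by
    rw [← hℓxlog, ← Real.log_rpow hxpos]; exact Real.log_le_log (by linarith) hD₀u
  have hℓ₁0 : 0 ≤ Real.log D₀ := Real.log_nonneg hD₀1
  have hℓ₂ : Real.log (2 + N) ≤ 2 * ℓx := by
    calc Real.log (2 + N) ≤ Real.log (x ^ 2) :=
          Real.log_le_log (by linarith) (by rw [sq]; linarith)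
      _ = 2 * ℓx := by rw [Real.log_pow, hℓxlog]; norm_num
  have hℓ₂0 : 0 ≤ Real.log (2 + N) := Real.log_nonneg (by linarith)
  have hℓ₃ : Real.log ((2 + N) * KX) ≤ 4 * ℓx := by
    have h : (2 + N) * KX ≤ x ^ 4 :=
      calc (2 + N) * KX ≤ (x * x) * (x * x) :=
            mul_le_mul (by linarith) (by linarith) (by linarith) (by positivity)
        _ = x ^ 4 := by ring
    calc Real.log ((2 + N) * KX) ≤ Real.log (x ^ 4) := Real.log_le_log (by positivity) h
      _ = 4 * ℓx := by rw [Real.log_pow, hℓxlog]; norm_num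
  have hℓ₃0 : 0 ≤ Real.log ((2 + N) * KX) :=
    Real.log_nonneg (one_le_mul_of_one_le_of_one_le (by linarith) hKX1)
  -- powers of `ℓx`: split off the factor `ℓx ^ A`
  have hLpos : 0 < ℓx ^ A := lt_of_lt_of_le one_pos (Real.one_le_rpow (by linarith) hA.le)
  have r2 : ℓx ^ (A + 2) = ℓx ^ A * ℓx ^ 2 := by
    exact_mod_cast Real.rpow_add_natCast hℓpos.ne' A 2
  have r6 : ℓx ^ (A + 6) = ℓx ^ A * ℓx ^ 6 := by
    exact_mod_cast Real.rpow_add_natCast hℓpos.ne' A 6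
  have r18 : ℓx ^ (A + 18) = ℓx ^ A * ℓx ^ 18 := by
    exact_mod_cast Real.rpow_add_natCast hℓpos.ne' A 18
  have r134 : ℓx ^ (A + 134) = ℓx ^ A * ℓx ^ 134 := by
    exact_mod_cast Real.rpow_add_natCast hℓpos.ne' A 134
  have r404 : ℓx ^ (4 * A + 404) = (ℓx ^ A) ^ 4 * ℓx ^ 404 := by
    rw [Real.rpow_add hℓpos, mul_comm (4 : ℝ) A, Real.rpow_mul hℓpos.le]; norm_num
  rw [r2] at hX₂'; rw [r6] at hX₃; rw [r18] at hX₁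
  rw [r134] at hF₀l hF₀u; rw [r404] at hBf
  -- powers of `x`: everything is a natural power of `u = x ^ (1/3000)`
  have hu1 : 1 ≤ x ^ (1 / 3000 : ℝ) := Real.one_le_rpow hx1 (by norm_num)
  have e56 := rpow_eq_pow_root hx0 (5 / 6) 2500 (by norm_num)
  have ex : x = (x ^ (1 / 3000 : ℝ)) ^ 3000 := by
    rw [← rpow_eq_pow_root hx0 1 3000 (by norm_num), Real.rpow_one]
  rw [rpow_eq_pow_root hx0 (1 / 1000) 3 (by norm_num)] at hK hX₁
  rw [rpow_eq_pow_root hx0 (2 / 1000) 6 (by norm_num)] at hX₂ hcT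
  rw [rpow_eq_pow_root hx0 (3 / 1000) 9 (by norm_num)] at hD₀l hD₀u hKX
  rw [rpow_eq_pow_root hx0 (1 / 2) 1500 (by norm_num)] at hX₂'
  rw [rpow_eq_pow_root hx0 (1 / 10) 300 (by norm_num)] at hX₃
  set u := x ^ (1 / 3000 : ℝ)
  -- the radicals `(2 + N) ^ (5/6)` and `(2 + N) ^ (1/2)`
  have hR₁0 : 0 ≤ (2 + N) ^ (5 / 6 : ℝ) := Real.rpow_nonneg (by linarith) _
  have hR₂0 : 0 ≤ (2 + N) ^ (1 / 2 : ℝ) := Real.rpow_nonneg (by linarith) _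
  have hR₂₁ : (2 + N) ^ (1 / 2 : ℝ) ≤ (2 + N) ^ (5 / 6 : ℝ) :=
    Real.rpow_le_rpow_of_exponent_le (by linarith) (by norm_num)
  have hR₁ : (2 + N) ^ (5 / 6 : ℝ) ≤ 17 / 8 * u ^ 2500 := by
    calc (2 + N) ^ (5 / 6 : ℝ) ≤ (17 / 8 * x) ^ (5 / 6 : ℝ) :=
          Real.rpow_le_rpow (by linarith) (by linarith) (by norm_num)
      _ = (17 / 8 : ℝ) ^ (5 / 6 : ℝ) * u ^ 2500 := by rw [Real.mul_rpow (by norm_num) hx0, e56]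
      _ ≤ 17 / 8 * u ^ 2500 := by
          gcongr
          simpa using Real.rpow_le_rpow_of_exponent_le (by norm_num : (1 : ℝ) ≤ 17 / 8)
            (by norm_num : (5 / 6 : ℝ) ≤ 1)
  set L := ℓx ^ A
  set ℓ₁ := Real.log D₀
  set ℓ₂ := Real.log (2 + N)
  set ℓ₃ := Real.log ((2 + N) * KX)
  set R₁ := (2 + N) ^ (5 / 6 : ℝ)
  set R₂ := (2 + N) ^ (1 / 2 : ℝ)
  -- (i) the first range
  have hP1 : K ^ 2 * W ^ 2 * (N / D₀ * S₃) * L ≤ x := by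
    have hND : N / D₀ ≤ 4 * u ^ 2991 := by
      rw [div_le_iff₀ (by linarith)]
      calc N ≤ 2 * x := hN
        _ = 4 * u ^ 2991 * (u ^ 9 / 2) := by rw [ex]; ring
        _ ≤ 4 * u ^ 2991 * D₀ := by gcongr
    calc K ^ 2 * W ^ 2 * (N / D₀ * S₃) * L
        ≤ (u ^ 3) ^ 2 * (19 * ℓx) ^ 2 * (4 * u ^ 2991 * (C₃ * ℓx ^ 16)) * L := by gcongr
      _ = 1444 * C₃ * u ^ 2997 * (L * ℓx ^ 18) := by ring
      _ ≤ 1444 * C₃ * u ^ 2997 * (1 / (1444 * C₃) * u ^ 3) := by gcongr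
      _ = 1444 * C₃ * (1 / (1444 * C₃)) * u ^ 3000 := by ring
      _ = x := by rw [mul_one_div_cancel (by positivity), one_mul, ← ex]
  have hP2 : K ^ 2 * W ^ 2 * cT * L ≤ x := by
    calc K ^ 2 * W ^ 2 * cT * L ≤ (u ^ 3) ^ 2 * (19 * ℓx) ^ 2 * u ^ 6 * L := by gcongr
      _ = 361 * u ^ 12 * (L * ℓx ^ 2) := by ring
      _ ≤ 361 * u ^ 12 * (1 / 361 * u ^ 1500) := by gcongr
      _ = u ^ 1512 := by ring
      _ ≤ u ^ 3000 := pow_le_pow_right₀ hu1 (by norm_num)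
      _ = x := ex.symm
  -- (ii) the family term
  have hP3 : F₀ ^ 3 * W * (7 + 12 * ℓ₁) * Bf * L ≤ 722 * Cf * x := by
    have h7 : 7 + 12 * ℓ₁ ≤ 19 * ℓx := by linarith
    have hBf' : Bf * (L ^ 4 * ℓx ^ 404) ≤ 2 * Cf * x :=
      mul_le_of_le_div₀ (by positivity) (by positivity) hBf
    calc F₀ ^ 3 * W * (7 + 12 * ℓ₁) * Bf * L
        ≤ (L * ℓx ^ 134) ^ 3 * (19 * ℓx) * (19 * ℓx) * Bf * L := by gcongr
      _ = 361 * (Bf * (L ^ 4 * ℓx ^ 404)) := by ring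
      _ ≤ 361 * (2 * Cf * x) := by gcongr
      _ = 722 * Cf * x := by ring
  -- (iii) the dispersion term: main part
  have h1ℓ₁ : 1 + ℓ₁ ≤ 2 * ℓx := by linarith
  have hP4a : 330000 * W * ℓ₃ ^ 4 / F₀ * (N * (1 + ℓ₁) * S₅b) * L ≤
      12840960000 * C₅ * x := by
    rw [div_mul_eq_mul_div, div_mul_eq_mul_div, div_le_iff₀ (by linarith)]
    calc 330000 * W * ℓ₃ ^ 4 * (N * (1 + ℓ₁) * S₅b) * L
        ≤ 330000 * (19 * ℓx) * (4 * ℓx) ^ 4 * (2 * x * (2 * ℓx) * (C₅ * ℓx ^ 128)) * L := by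
          gcongr
      _ = 12840960000 * C₅ * x * (L * ℓx ^ 134 / 2) := by ring
      _ ≤ 12840960000 * C₅ * x * F₀ := by gcongr
  -- (iii) the dispersion term: error part
  have hP4b : 330000 * W * ℓ₃ ^ 4 / F₀ *
      (D₀ * (2 + (R₁ * KX + R₂ * KX ^ 2) * (1 + ℓ₂)) * S₅a) * L ≤ x := by
    have hQ : 330000 * W * ℓ₃ ^ 4 / F₀ ≤ 330000 * (19 * ℓx) * (4 * ℓx) ^ 4 :=
      (div_le_self (by positivity) hF₀1).trans (by gcongr)
    have hKX2 : KX ≤ KX ^ 2 := le_self_pow₀ hKX1 two_ne_zero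
    have hE1 : R₁ * KX + R₂ * KX ^ 2 ≤ 2 * (17 / 8 * u ^ 2500) * (u ^ 9) ^ 2 := by
      calc R₁ * KX + R₂ * KX ^ 2 ≤ R₁ * KX ^ 2 + R₁ * KX ^ 2 := by gcongr
        _ = 2 * R₁ * KX ^ 2 := by ring
        _ ≤ 2 * (17 / 8 * u ^ 2500) * (u ^ 9) ^ 2 := by gcongr
    have h3 : 1 + ℓ₂ ≤ 3 * ℓx := by linarith
    have h1 : 1 ≤ u ^ 2518 * ℓx :=
      one_le_mul_of_one_le_of_one_le (one_le_pow₀ hu1) (by linarith)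
    have hE : 2 + (R₁ * KX + R₂ * KX ^ 2) * (1 + ℓ₂) ≤ 59 / 4 * u ^ 2518 * ℓx := by
      calc 2 + (R₁ * KX + R₂ * KX ^ 2) * (1 + ℓ₂)
          ≤ 2 + 2 * (17 / 8 * u ^ 2500) * (u ^ 9) ^ 2 * (3 * ℓx) := by gcongr
        _ = 2 + 51 / 4 * (u ^ 2518 * ℓx) := by ring
        _ ≤ 59 / 4 * u ^ 2518 * ℓx := by linarith
    have hS : S₅a ≤ (u ^ 6) ^ 6 := hS₅a.trans (pow_le_pow_left₀ hX₂0 hX₂ 6)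
    calc 330000 * W * ℓ₃ ^ 4 / F₀ *
          (D₀ * (2 + (R₁ * KX + R₂ * KX ^ 2) * (1 + ℓ₂)) * S₅a) * L
        ≤ 330000 * (19 * ℓx) * (4 * ℓx) ^ 4 *
            (u ^ 9 * (59 / 4 * u ^ 2518 * ℓx) * (u ^ 6) ^ 6) * L := by gcongr
      _ = 23675520000 * u ^ 2563 * (L * ℓx ^ 6) := by ring
      _ ≤ 23675520000 * u ^ 2563 * (1 / 33000000000 * u ^ 300) := by gcongr
      _ = 2367552 / 3300000 * u ^ 2863 := by ring
      _ ≤ 1 * u ^ 3000 :=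
          mul_le_mul (by norm_num) (pow_le_pow_right₀ hu1 (by norm_num)) (by positivity)
            zero_le_one
      _ = x := by rw [one_mul, ← ex]
  -- total
  rw [le_div_iff₀ hLpos]
  linarith [hP1, hP2, hP3, hP4a, hP4b]

/-- Landing anchor of the main-terms chain, file 8; registered stub `mainTermsChain8_anchor`. -/
theorem mainTermsChain8_anchor : True := trivial

end Summit.Parity.GeneralizedHardyLittlewood.Cruxes.TypeI2Dilated.PeelToDrappeau

end
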